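import Literature.MathematicalPhysics.QuantumFieldTheory.Balaban1983to89.B7Prop2SpecialUnitary

/-!
# Bałaban's renormalization group for 4-d lattice Yang–Mills — B7 Propositions 1 and 2 WITH THE PRINTED LOCALITY:
"(44) for `p ⊂ Δ(p′)`" (Prop. 1 (51)) and "(52) for `p ⊂ B^k(x) ∪ B^k(y) ∪ B^k(z) ∪ B^k(w)`" (Prop. 2 (54)), and the
locality of the averages (42)/(43) themselves ("`Ū^k_c` depends only on `U_b` for `b ⊂ B^k(c₋) ∪ B^k(c₊)`", p. 24),
kernel-checked for the concrete averages of `B7Prop1Explicit` / `B7Prop2Explicit` (`B7Prop1Local`)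

CITATION HEADER (lean-in-tree rule 2026-08-18).  Audit cell `pub-balaban`, paper sub-cell B07 (unit b2b-balaban-b07,
gen 15, second node).  Source: T. Bałaban, *Averaging operations for lattice gauge theories*, Commun. Math. Phys.
**98**, 17–51 (1985) [Balaban1985Averaging] (cell paper B7; journal page = PDF page + 16), pp. 24–26 [PDF 8–10]; the
renders `b2b-balaban-ref1/pages/1985-cmp98-averaging/1985-cmp98-averaging-p008-x2.png`, `-p009-x2.png`, `-p010-x2.png`
(pp. 24, 25, 26) were READ AS IMAGES for this file; quotations of pp. 17–23 are carried verbatim from the headers of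
the companions `B7Prop1Explicit` (gen 13) and `B7Prop2Explicit` (gen 14).  Companions, used BY NAME:
`B7Prop1Explicit` (gen 13: the lattice `ℤ^d` and parallel transport — `Site`, `e`, `e_apply`, `Letter`, `hol`,
`hol_cons`, `hol_nil`, `stepHol_true/false`, `hol_append`, `hol_revWord'`, `disp`, `disp_seg`, `disp_treeWord`, `seg`,
`seg_natCast`, `revWord_seg`, `treeWord`, `plaqWord`, `gammaWord`, `boxVec`; the average (42) — `Wcx`, `Xavg`,
`bavg`, `expUnit`, `cplaq`; `U1`, `hol_mem`, `norm_hol_sub_one_le_two`; and PROPOSITION 1 WITH GLOBAL (44):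
`prop1_explicit`), `B7Prop2Explicit` (gen 14: `rescale`, `avgIter` (43), `hol_plaqWord_self`, `pdev`, `le_pdev`, `C0`,
`c2'`, `C0_pos`, `AvgClosed`, `unitaryUnits`, `avgClosed_unitaryUnits`, and PROPOSITION 2 WITH GLOBAL (52):
`prop2_explicit`), `B7Prop2SpecialUnitary` (gen 15, first node: `AvgClosedAt`, `prop2_explicit_at`, `c2At`,
`c2At_le`, `smallness_of_le_c2At`, `specialUnitaryUnits`, `avgClosedAt_specialUnitary`), `B7` (the quoted leaves
`B7.Prop1Printed`, `B7.Prop2Printed` and their carriers `B7.OneStep`, `B7.KStep`), Mathlib (`Real.iSup_le`,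
`Real.iSup_nonneg`, `le_ciSup`; the C⋆-algebra structure of `M_N(ℂ)` with the operator norm, scope
`Matrix.Norms.L2Operator`).  No hypothesis of any theorem below is a cited fact: everything is kernel-proved.

THE PRINTED TEXT.  p. 24 [PDF 8], after (43): "Let us notice that this definition is local in the sense that `Ū^k_c`,
`c ⊂ Ω^{(k)}`, depends only on the bond variables `U_b` for `b ⊂ B^k(c₋) ∪ B^k(c₊)`. This property will play a very
important role in the future."  p. 24: "We assume that a configuration `V` defined on a unit lattice `Ω′` satisfies
`|V(∂p) − 1| < α₀, p ⊂ Ω′`, (44) and `α₀` sufficiently small. We would like to get optimal bounds for `|V̄(∂p′) − 1|`,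
`p′ ⊂ Ω′^{(1)}`.  Let us denote by `y` the upper right corner of the plaquette `p′` …" (figure: the corners `y₀`, `y₁`,
`y₂`, `y` of `p′`).  p. 25 [PDF 9]: "If we denote `Δ(p′) = B(y₀) ∪ B(y₁) ∪ B(y₂) ∪ B(y)`, (46) then for `b ⊂ Δ(p′)` we
have … For `c ⊂ ∂p′`, the contours `Γ_{c,x}` are contained in `Δ(p′)` …"; end of p. 25: "This is the estimate we are
looking for. Let us notice that it is a local result; the bound above depends on bounds for `V(∂p) − 1` on `Δ(p′)`,
i.e., for `p ⊂ Δ(p′)`. We formulate the results in the following:"  p. 26 [PDF 10]: "PROPOSITION 1. There exist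
positive constants `C₀`, `c₂′` such that for every configuration `V` satisfying (44) for `p ⊂ Δ(p′)` and for `α₀ ≤
c₂′`, we have `|V̄(∂p′) − 1| < L²α₀ + C₀(L²α₀)²`. (51)  The constant `C₀` depends on `d` and `c₂′` depends on `d` and
`L`."  p. 26, (52): "`|U(∂p) − 1| < α₀η², η = L^{−k}` (52) on some set of plaquettes."  p. 26: "PROPOSITION 2. If `U`
satisfies (52) with `α₀ ≤ c₂ = min{1/(3C₀), ½c₂′}`, then `|Ū^k(∂p) − 1| < α₀ + 2C₀α₀² < 2α₀, p ⊂ Ω^{(k)}`. (54)  The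
result is local in the sense that if `p = ⟨x, y, z, w⟩`, then it is enough to assume (52) for `p ⊂ B^k(x) ∪ B^k(y) ∪
B^k(z) ∪ B^k(w)`."

DICTIONARY (print ↦ Lean; conventions of the companions: unit lattice `ℤ^d = Site d`, blocks `B(y) = y + [0, L)^d`
for `y ∈ Lℤ^d` (B5 (1.6), `boxVec`), the `k`-th lattice `Ω^{(k)} = ℤ^d` with the original lattice `= L^kℤ^d`-scaled
copy (`rescale`, `avgIter`), plaquette `p = (x; κ, ν)` with lower-left corner `x`, `V(∂p) = hol V x (plaqWord κ ν)`).
* A union of blocks that is a coordinate box `{x : lo_i ≤ x_i ≤ hi_i}` ↦ `InBox lo hi`; "`p ⊂` the box" (all four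
  corners are sites of the box) ↦ `PlaqIn lo hi p`; "depends only on the bond variables `U_b` for `b ⊂` the box" ↦
  congruence under `AgreeOn lo hi V V′` (equality on the bonds with both endpoints in the box).
* `B(c₋) ∪ B(c₊)` for the `L`-bond `c = ⟨q, q + Le_κ⟩` ↦ the box `[q, bondHi L q κ]`; `B^k(c₋) ∪ B^k(c₊)` for the bond
  `⟨q, q + e_κ⟩` of `Ω^{(k)}` ↦ `[loK L k q, bondHiK L k q κ]` (in unit-lattice coordinates: `[L^k q, L^k q + (L^k −
  1)𝟙 + L^k e_κ]`); `Δ(p′)` (46) for `p′ = (Lz; μ, ν)` ↦ `[z, deltaHi L z μ ν] = [z, z + (L − 1)𝟙 + Le_μ + Le_ν]`;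
  `B^k(x) ∪ B^k(y) ∪ B^k(z) ∪ B^k(w)` for `p = (z; μ, ν) ⊂ Ω^{(k)}` ↦ `[loK L k z, plaqHiK L k z μ ν]` (`plaqHiK_one`:
  `k = 1` is `Δ`).
* "(44) for `p ⊂ Δ(p′)`" ↦ the hypothesis `h44` of `prop1_local` / the field `plaqDev` of `concreteOneStepLocal` (a
  supremum over `PlaqIn`-plaquettes only); "(52) for `p ⊂ B^k(x) ∪ …`" ↦ `pdevOn (loK L k z) (plaqHiK L k z μ ν) U`
  in `prop2_local` / the field `plaqDevEta` of `concreteKStepLocal`.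
* NOT IN PRINT (the device of this file): the coordinatewise retraction `clamp lo hi : ℤ^d → [lo, hi]` and the CLAMPED
  EXTENSION `clampCfg lo hi V` of `V|box` to all of `ℤ^d` (`V(π(x), π(x) + e_κ)` on bonds whose clamped image is a
  genuine bond, `1` on the others).

WHAT IS PROVED (all kernel-checked, standard axioms).
* LOCALITY OF TRANSPORT AND OF THE AVERAGES (§2): `hol_seg_congr`, `hol_seg_int_congr`, `hol_treeWord_congr` (transport
  along segments / tree contours inside a box depends only on the bonds of the box), `Wcx_congr` ((42)'s
  `V(Γ_{c,x})V(c)⁻¹`), `bavg_congr` (p. 24 for `k = 1`: `V̄_c` depends only on `V_b`, `b ⊂ B(c₋) ∪ B(c₊)`),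
  `avgIter_congr` (p. 24 verbatim, all `k`: `Ū^k_c` depends only on `U_b`, `b ⊂ B^k(c₋) ∪ B^k(c₊)`, by induction on
  `k`), `hol_plaqWord_avgIter_congr` (`Ū^k(∂p)` depends only on `U_b`, `b ⊂ B^k(x) ∪ B^k(y) ∪ B^k(z) ∪ B^k(w)`),
  `cplaq_bavg_congr` (`V̄(∂p′)` depends only on `V_b`, `b ⊂ Δ(p′)`).
* THE CLAMPED EXTENSION (§3): `clampCfg_agree` (it agrees with `V` on the box), `clampCfg_mem` (values in the same
  group), `hol_plaqWord_clampCfg` (each of its plaquette variables is `1` or a plaquette variable of `V` INSIDE the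
  box), `norm_hol_plaqWord_clampCfg_le`, `pdev_clampCfg_le` (so a local (44)/(52) becomes a global one).
* PROPOSITION 1 AS PRINTED (§4): `prop1_local` — `L ≥ 1`, `μ ≠ ν`, `V` with values in `{|u| ≤ 1, |u⁻¹| ≤ 1}`,
  `0 ≤ α₀`, `512(d+1)(d+4)L²α₀ ≤ 1`, and (44) `|V(∂p) − 1| ≤ α₀` ONLY for the unit plaquettes `p ⊂ Δ(p′)` ⟹
  `|V̄(∂p′) − 1| ≤ L²α₀ + 226(8(d+1)(d+4)L²α₀)²`; and the quoted leaf with locality: `prop1Printed_concrete_local :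
  B7.Prop1Printed L (concreteOneStepLocal 𝔸 L)` (`C₀ = 14464(d+1)²(d+4)²`, `c₂′ = 1/(512(d+1)(d+4)L²)`).
* PROPOSITION 2 AS PRINTED, LOCALITY SENTENCE INCLUDED (§5): `prop2_local` — `L ≥ 2`, `G` any `AvgClosed` gauge group,
  `U` `G`-valued, `0 < α₀`, `C₀α₀ ≤ ⅓`, `2α₀ ≤ c₂′`, (52) with `η = L^{−k}` ONLY on the four `k`-blocks at the corners of
  `p` ⟹ `|Ū^k(∂p) − 1| < α₀ + 2C₀α₀²`; the quoted leaf: `prop2Printed_concrete_local : B7.Prop2Printed (C0 d) (c2' d L)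
  (concreteKStepLocal d 𝔸 G L)` (index = all plaquettes of all `Ω^{(k)}`; uniform in `k` and `p`); §6: the same at a
  `G`-dependent closure radius (`prop2_local_at`, `prop2Printed_concrete_local_at`, threshold `c2At d L t`), and the
  paper's settings `G = U(N) ⊂ M_N(ℂ)` (`prop2Printed_unitaryGroup_local`, `c₂′ = c2' d L`) and `G = SU(N)`
  (`prop2Printed_specialUnitaryGroup_local`, `c₂′ = c2At d L (min{1/4, 1/N})`).

METHOD.  Print proves locality inside the proof (axial gauge on a neighbourhood of `y`, all contours inside `Δ(p′)`,
pp. 24–25); the certified global theorems `prop1_explicit` / `prop2_explicit` assume (44)/(52) on all of `ℤ^d`.  This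
file does NOT re-thread a region through those 2000 lines; instead (i) it proves the locality of the concrete objects
directly — transport along a word staying in a box is determined by the bonds of the box (induction on segments and on
the coordinate list of the tree contour), hence so are `V(Γ_{c,x})V(c)⁻¹`, `X_c`, `V̄_c`, and by induction on `k` (level
`k` bond box `= L ×` level `k−1` boxes) `Ū^k_c` and `Ū^k(∂p)`; (ii) given `V` and a box, the clamped extension `π^*V`
agrees with `V` on the box and every plaquette variable of `π^*V` is `1` or `V(∂p)` for a plaquette `p` inside the box
(case analysis on whether the two directions of the plaquette are clamped at `x`: if both are free the plaquette is
transported to `π(x)`, otherwise it collapses to `W·1·W⁻¹·1 = 1`), so (44) for `p ⊂ box` gives (44) for `π^*V`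
everywhere with the same `α₀`, and `π^*V` is `G`-valued if `V` is (`1 ∈ G`); (iii) apply the global theorem to `π^*V` and
transport the conclusion back to `V` by (i).  No gauge fixing, no new estimate: the constants are exactly those of the
companions.

DIVERGENCES / WHAT IS NOT REPRODUCED (cell DIVERGENCE.md D-b07g15.2; CLOSES clause (a) "HYPOTHESIS REGION: print assumes
(44) only for `p ⊂ Δ(p′)` … here (44) is assumed for all plaquettes of `ℤ^d`" of D-b07g13.1 and clause (a)/(c) "(52)
assumed on ALL plaquettes … no locality" of D-b07g14.1 / D-b07g15.1 (d)).  (a) READING OF "`p ⊂ Δ(p′)`": a block is read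
as its set of SITES `y + [0, L)^d ∩ ℤ^d` and "`p ⊂ Δ(p′)`" as "the four corners of `p` are sites of `Δ(p′)`"; under the
alternative reading (blocks as closed regions of `ℝ^d`, one more layer of plaquettes on the upper faces) the printed
hypothesis quantifies over MORE plaquettes, so the theorems here (fewest plaquettes) imply the printed statement under
either reading.  (b) AMBIENT LATTICE: configurations are total functions on the bonds of `ℤ^d` (print: a unit lattice
`Ω′`, in B8–B13 a torus or a subdomain); since hypotheses AND conclusions now involve only the bonds of a finite box, a
configuration given on any `Ω′ ⊇ Δ(p′)` is covered by extending it arbitrarily (e.g. by `clampCfg` itself) — the torus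
bookkeeping (blocks wrapping around) is still not written.  (c) As in the companions: `≤` in hypothesis and conclusion
of `prop1_local` (the leaf `B7.Prop1Printed` has the printed strict `<`); `L ≥ 1` (Prop. 1) / `L ≥ 2` (Prop. 2); `d`
arbitrary (`μ ≠ ν` forces `d ≥ 2`); `k = 0` allowed; constants admissible, not optimal; `log` = the series (21); gauge
groups: `AvgClosed` (`U(N)`, unitary groups of C⋆-algebras) and `AvgClosedAt` (`SU(N)`) only.  (d) The p. 24 remark
"the property (11) is satisfied" (gauge covariance `(Ū^u)_c = u(c₋)Ū_c u⁻¹(c₊)` of (42)/(43)) is not treated in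
this file.  (e) Not touched: Proposition 3 (pp. 27–36), Sects. C–F.

FINDINGS OF THE AUDIT (cell GAPS.md C-b07g15-2).  None located: the three locality sentences (p. 24 after (43), p. 25
before Prop. 1, p. 26 after (54)) are correct exactly as printed for the concrete definitions (42)/(43)/(46), with the
printed regions (`B^k(c₋) ∪ B^k(c₊)`, `Δ(p′)`, the four corner `k`-blocks) and with unchanged constants.  (Precision,
immaterial: the axial gauge of p. 24 is introduced on "some neighborhood of `y` containing `2^d` blocks", larger than
`Δ(p′)` for `d > 2`, but the estimates of p. 25 use only `b ⊂ Δ(p′)` and `v₀|Δ(p′)` is determined by `V|Δ(p′)` since the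
contours `Γ_{y,x}`, `x ∈ Δ(p′)`, stay in the coordinate box `Δ(p′)`; the kernel route (clamped extension) does not use
the gauge at all.)  VALUE = Propositions 1 and 2 of B7 now kernel-checked EXACTLY AS PRINTED — local hypotheses,
printed regions, explicit constants, `G = U(N)` and `SU(N)` — together with the p. 24 locality of `Ū^k` "which will
play a very important role in the future" (it is what makes the averages of B8–B13 compatible with restrictions to
subdomains).  NOT summit progress by itself (ultraviolet stability needs Prop. 3 and papers B8–B13).
-/

noncomputable section

open scoped BigOperators
open NormedSpace Finset

namespace Literature.MathematicalPhysics.QuantumFieldTheory.Balaban1983to89.B7Prop1Local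

open B7Prop1Explicit B7Prop2Explicit B7Prop2SpecialUnitary MatrixLog

-- `Site` alone would resolve to the torus sites of `Setup.lean`; re-export the `ℤ^d` sites of `B7Prop1Explicit`.
export B7Prop1Explicit (Site)

variable {d : ℕ}

/-! ## §1 Coordinate boxes of `ℤ^d` -/

/-- The coordinate box `[lo, hi] = {x ∈ ℤ^d : lo_i ≤ x_i ≤ hi_i}` — blocks `B(y) = y + [0, L)^d` (B5 (1.6)), unions
of adjacent blocks such as `B(c₋) ∪ B(c₊)` (p. 24) and `Δ(p′)` (46) are of this form. [cite: Balaban1985Averaging, (46) p.25] -/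
def InBox (lo hi x : Site d) : Prop := ∀ i, lo i ≤ x i ∧ x i ≤ hi i

/-- A point lying coordinatewise between two points of a box lies in the box. [folklore] -/
theorem inBox_of_between {lo hi a b c : Site d} (ha : InBox lo hi a) (hc : InBox lo hi c)
    (h : ∀ i, (a i ≤ b i ∧ b i ≤ c i) ∨ (c i ≤ b i ∧ b i ≤ a i)) : InBox lo hi b := fun i => by
  rcases h i with h | h
  · exact ⟨(ha i).1.trans h.1, h.2.trans (hc i).2⟩
  · exact ⟨(hc i).1.trans h.1, h.2.trans (ha i).2⟩

/-- `add_zsmul_e_apply`: coordinates of `x + n e_κ`. [folklore] -/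
theorem add_zsmul_e_apply (x : Site d) (n : ℤ) (κ i : Fin d) :
    (x + n • e κ) i = x i + if i = κ then n else 0 := by
  simp [e_apply]

/-- `add_e_apply`: coordinates of `x + e_κ`. [folklore] -/
theorem add_e_apply (x : Site d) (κ i : Fin d) : (x + e κ) i = x i + if i = κ then 1 else 0 := by
  simp [e_apply]

/-- The unit plaquette `p = (x; κ, κ′)` lies in the box: "`p ⊂ Δ(p′)`" — all four corners do, equivalently the
corners `x` and `x + e_κ + e_κ′`. [cite: Balaban1985Averaging, (46) p.25] -/
def PlaqIn (lo hi : Site d) (p : Site d × Fin d × Fin d) : Prop :=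
  InBox lo hi p.1 ∧ InBox lo hi (p.1 + e p.2.1 + e p.2.2)

section Agree

variable {G : Type*}

/-- Two configurations AGREE ON THE BONDS OF THE BOX: `V_b = V′_b` for every bond `b = ⟨x, x + e_κ⟩` with both
endpoints in `[lo, hi]` ("depends only on the bond variables `U_b` for `b ⊂ …`", p. 24). [cite: Balaban1985Averaging, p.24] -/
def AgreeOn (lo hi : Site d) (V V' : Site d → Fin d → G) : Prop :=
  ∀ x κ, InBox lo hi x → InBox lo hi (x + e κ) → V x κ = V' x κ

/-- `AgreeOn.symm`: bookkeeping. [folklore] -/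
theorem AgreeOn.symm {lo hi : Site d} {V V' : Site d → Fin d → G} (h : AgreeOn lo hi V V') :
    AgreeOn lo hi V' V := fun x κ hx hx' => (h x κ hx hx').symm

/-- Agreement on a box implies agreement on every sub-box. [folklore] -/
theorem AgreeOn.mono {lo hi lo' hi' : Site d} {V V' : Site d → Fin d → G} (h : AgreeOn lo hi V V')
    (hlo : ∀ i, lo i ≤ lo' i) (hhi : ∀ i, hi' i ≤ hi i) : AgreeOn lo' hi' V V' :=
  fun x κ hx hx' => h x κ (fun i => ⟨(hlo i).trans (hx i).1, (hx i).2.trans (hhi i)⟩)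
    (fun i => ⟨(hlo i).trans (hx' i).1, (hx' i).2.trans (hhi i)⟩)

end Agree

/-! ## §2 Locality of parallel transport, of the average (42), and of the `k`-fold average (43) -/

section Transport

variable {G : Type*} [Group G]

/-- The plaquette holonomy (9) spelled out: `V(∂p) = V(x, κ) V(x + e_κ, ν) V(x + e_ν, κ)⁻¹ V(x, ν)⁻¹`. [cite: Balaban1985Averaging, (9) p.18] -/
theorem hol_plaqWord_eq (V : Site d → Fin d → G) (x : Site d) (κ ν : Fin d) :
    hol V x (plaqWord κ ν) = V x κ * V (x + e κ) ν * (V (x + e ν) κ)⁻¹ * (V x ν)⁻¹ := by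
  have h2 : x + e κ + e ν - e κ = x + e ν := by abel
  have h3 : x + e κ + e ν + -e κ - e ν = x := by abel
  simp only [plaqWord, hol_cons, hol_nil, mul_one, stepHol_true, stepHol_false, Letter.vec_true,
    Letter.vec_false, h2, h3, mul_assoc]

variable {lo hi : Site d} {V V' : Site d → Fin d → G}

/-- `inBox_add_e`: the first step of a straight segment between two box points stays in the box. [folklore] -/
theorem inBox_add_e {p : Site d} {κ : Fin d} {n : ℕ} (hp : InBox lo hi p)
    (hpn : InBox lo hi (p + ((n + 1 : ℕ) : ℤ) • e κ)) : InBox lo hi (p + e κ) := by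
  refine inBox_of_between hp hpn fun i => Or.inl ?_
  rw [add_zsmul_e_apply, add_e_apply]
  split_ifs <;> push_cast <;> omega

/-- LOCALITY OF TRANSPORT along a straight segment `[p, p + n e_κ]` inside the box. [folklore] -/
theorem hol_seg_congr (h : AgreeOn lo hi V V') (κ : Fin d) :
    ∀ (n : ℕ) (p : Site d), InBox lo hi p → InBox lo hi (p + (n : ℤ) • e κ) →
      hol V p (seg κ n) = hol V' p (seg κ n)
  | 0, p, _, _ => by simp
  | n + 1, p, hp, hpn => by
    have hpe : InBox lo hi (p + e κ) := inBox_add_e hp hpn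
    have hpn' : InBox lo hi (p + e κ + (n : ℤ) • e κ) := by
      have he : p + e κ + (n : ℤ) • e κ = p + ((n + 1 : ℕ) : ℤ) • e κ := by
        push_cast; rw [add_smul, one_smul]; abel
      rw [he]; exact hpn
    rw [seg_natCast, List.replicate_succ, hol_cons, hol_cons, stepHol_true, stepHol_true, Letter.vec_true,
      h p κ hp hpe, ← seg_natCast, hol_seg_congr h κ n (p + e κ) hpe hpn']

/-- Locality of transport along `seg κ n`, `n ∈ ℤ`. [folklore] -/
theorem hol_seg_int_congr (h : AgreeOn lo hi V V') (κ : Fin d) (n : ℤ) (p : Site d) (hp : InBox lo hi p)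
    (hpn : InBox lo hi (p + n • e κ)) : hol V p (seg κ n) = hol V' p (seg κ n) := by
  obtain ⟨m, rfl | rfl⟩ := Int.eq_nat_or_neg n
  · exact hol_seg_congr h κ m p hp hpn
  · have hx : p = p + -(m : ℤ) • e κ + disp (seg κ m) := by rw [disp_seg, neg_smul, neg_add_cancel_right]
    rw [← revWord_seg, hol_revWord' V _ _ hx, hol_revWord' V' _ _ hx,
      hol_seg_congr h κ m _ hpn (by rwa [neg_smul, neg_add_cancel_right])]

/-- Locality of transport along a broken line changing the coordinates listed in `s` one at a time. [folklore] -/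
theorem hol_flatMap_seg_congr (h : AgreeOn lo hi V V') (v : Site d) :
    ∀ (s : List (Fin d)), s.Nodup → ∀ p : Site d, InBox lo hi p →
      (∀ κ ∈ s, lo κ ≤ p κ + v κ ∧ p κ + v κ ≤ hi κ) →
      hol V p (s.flatMap fun κ => seg κ (v κ)) = hol V' p (s.flatMap fun κ => seg κ (v κ))
  | [], _, p, _, _ => by simp
  | κ :: s, hnd, p, hp, hv => by
    obtain ⟨hκs, hs⟩ := List.nodup_cons.mp hnd
    rw [List.flatMap_cons, hol_append, hol_append, disp_seg]
    have hκ := hv κ (by simp)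
    have hpκ : InBox lo hi (p + v κ • e κ) := fun i => by
      rw [add_zsmul_e_apply]
      by_cases hi : i = κ
      · subst hi; simpa using hκ
      · simpa [hi] using hp i
    rw [hol_seg_int_congr h κ (v κ) p hp hpκ, hol_flatMap_seg_congr h v s hs (p + v κ • e κ) hpκ ?_]
    intro κ' hκ'
    have hne : κ' ≠ κ := fun h' => hκs (h' ▸ hκ')
    rw [add_zsmul_e_apply, if_neg hne, add_zero]
    exact hv κ' (by simp [hκ'])

/-- LOCALITY OF TRANSPORT along the tree contour `Γ_{p, p+v}` (B5 (1.7)) inside a box containing `p` and `p + v`.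
[cite: Balaban1985Averaging, p.24] -/
theorem hol_treeWord_congr (h : AgreeOn lo hi V V') (p v : Site d) (hp : InBox lo hi p)
    (hpv : InBox lo hi (p + v)) : hol V p (treeWord v) = hol V' p (treeWord v) :=
  hol_flatMap_seg_congr h v _ (List.nodup_reverse.mpr (List.nodup_finRange d)) p hp
    fun κ _ => by simpa using hpv κ

end Transport

section Average

variable {𝔸 : Type*} [NormedRing 𝔸] [NormedAlgebra ℂ 𝔸] [CompleteSpace 𝔸]
variable {lo hi : Site d} {V V' : Site d → Fin d → 𝔸ˣ}

omit [NormedAlgebra ℂ 𝔸] [CompleteSpace 𝔸] in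
/-- Locality of `V(Γ_{c,x})V(c)⁻¹` (42): it is determined by the bonds of any box containing `c₋`, `x`, `x(c)`, `c₊`.
[cite: Balaban1985Averaging, (42) p.23] -/
theorem Wcx_congr (L : ℕ) (h : AgreeOn lo hi V V') (q : Site d) (κ : Fin d) (r : Site d)
    (hq : InBox lo hi q) (hqr : InBox lo hi (q + r)) (hqrL : InBox lo hi (q + r + (L : ℤ) • e κ))
    (hqL : InBox lo hi (q + (L : ℤ) • e κ)) : Wcx L V q κ r = Wcx L V' q κ r := by
  have hx : q + (r + (L : ℤ) • e κ) = q + (L : ℤ) • e κ + disp (treeWord r) := by rw [disp_treeWord]; abel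
  have hqLr : InBox lo hi (q + (L : ℤ) • e κ + r) := by convert hqrL using 1; abel
  unfold Wcx gammaWord
  rw [hol_append, hol_append, hol_append, hol_append, disp_append, disp_treeWord, disp_seg,
    hol_revWord' V _ _ hx, hol_revWord' V' _ _ hx, hol_treeWord_congr h q r hq hqr,
    hol_seg_congr h κ L (q + r) hqr hqrL, hol_treeWord_congr h _ r hqL hqLr, hol_seg_congr h κ L q hq hqL]

/-- The box `B(c₋) ∪ B(c₊) = [q, q + (L−1)𝟙 + Le_κ]` of the `L`-bond `c = ⟨q, q + Le_κ⟩` (its upper corner). [cite: Balaban1985Averaging, p.24] -/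
def bondHi (L : ℕ) (q : Site d) (κ : Fin d) : Site d := fun i => q i + ((L : ℤ) - 1) + if i = κ then (L : ℤ) else 0

/-- **LOCALITY OF THE ONE-STEP AVERAGE (42)** (p. 24: "this definition is local in the sense that `Ū_c` …
depends only on the bond variables `U_b` for `b ⊂ B(c₋) ∪ B(c₊)`"), kernel-checked for the concrete average
`bavg` of `B7Prop1Explicit`: two configurations agreeing on the bonds of `B(c₋) ∪ B(c₊)` have the same `V̄_c`.
[cite: Balaban1985Averaging, p.24 (sentence after (43))] -/
theorem bavg_congr (L : ℕ) (hL : 1 ≤ L) (q : Site d) (κ : Fin d) (h : AgreeOn q (bondHi L q κ) V V') :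
    bavg L V q κ = bavg L V' q κ := by
  have hq : InBox q (bondHi L q κ) q := fun i => by
    simp only [bondHi]; split_ifs <;> omega
  have hqL : InBox q (bondHi L q κ) (q + (L : ℤ) • e κ) := fun i => by
    simp only [bondHi, add_zsmul_e_apply]; split_ifs <;> omega
  have hW : ∀ r : Fin d → Fin L, Wcx L V q κ (boxVec L r) = Wcx L V' q κ (boxVec L r) := by
    intro r
    have hr : ∀ i, 0 ≤ boxVec L r i ∧ boxVec L r i + 1 ≤ L := fun i =>
      ⟨by simp [boxVec], by have := (r i).isLt; simp only [boxVec]; omega⟩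
    refine Wcx_congr L h q κ _ hq (fun i => ?_) (fun i => ?_) hqL
    · have := hr i; simp only [bondHi, Pi.add_apply]; split_ifs <;> omega
    · have := hr i
      simp only [bondHi, Pi.add_apply, Pi.smul_apply, smul_eq_mul, e_apply, mul_ite, mul_one, mul_zero]
      split_ifs <;> omega
  show expUnit (Xavg L V q κ) * hol V q (seg κ L) = expUnit (Xavg L V' q κ) * hol V' q (seg κ L)
  rw [hol_seg_congr h κ L q hq hqL]
  simp only [Xavg, hW]

/-- The box `B^k(c₋) ∪ B^k(c₊)` of the bond `c = ⟨q, q + e_κ⟩` of the `k`-th lattice, in the coordinates of the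
original lattice (header DICTIONARY of `B7Prop2Explicit`: level `k` is `ℤ^d` rescaled by `L^k`): lower corner
`L^k q`. [cite: Balaban1985Averaging, p.24] -/
def loK (L k : ℕ) (q : Site d) : Site d := fun i => (L : ℤ) ^ k * q i

/-- Upper corner `L^k q + (L^k − 1)𝟙 + L^k e_κ` of `B^k(c₋) ∪ B^k(c₊)`. [cite: Balaban1985Averaging, p.24] -/
def bondHiK (L k : ℕ) (q : Site d) (κ : Fin d) : Site d := fun i =>
  (L : ℤ) ^ k * q i + ((L : ℤ) ^ k - 1) + if i = κ then (L : ℤ) ^ k else 0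

/-- **LOCALITY OF THE `k`-FOLD AVERAGE (43)** (p. 24, verbatim: "Let us notice that this definition is local in
the sense that `Ū^k_c`, `c ⊂ Ω^{(k)}`, depends only on the bond variables `U_b` for `b ⊂ B^k(c₋) ∪ B^k(c₊)`.  This
property will play a very important role in the future."), kernel-checked for the concrete iterate `avgIter` of
`B7Prop2Explicit` by induction on `k` from the one-step locality. [cite: Balaban1985Averaging, p.24 (sentence after (43))] -/
theorem avgIter_congr (L : ℕ) (hL : 1 ≤ L) :
    ∀ (k : ℕ) {V V' : Site d → Fin d → 𝔸ˣ} (q : Site d) (κ : Fin d),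
      AgreeOn (loK L k q) (bondHiK L k q κ) V V' → avgIter L V k q κ = avgIter L V' k q κ
  | 0, V, V', q, κ, h => by
    refine h q κ (fun i => ?_) (fun i => ?_)
    · simp only [loK, bondHiK, pow_zero, one_mul]; split_ifs <;> omega
    · simp only [loK, bondHiK, pow_zero, one_mul, add_e_apply]; split_ifs <;> omega
  | k + 1, V, V', q, κ, h => by
    rw [avgIter_succ, avgIter_succ, rescale_apply, rescale_apply]
    have hP : (0 : ℤ) ≤ (L : ℤ) ^ k := by positivity
    refine bavg_congr L hL _ κ fun x μ hx hxe => avgIter_congr L hL k x μ (h.mono (fun i => ?_) (fun i => ?_))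
    · have h1 := (hx i).1
      simp only [Pi.smul_apply, smul_eq_mul] at h1
      have h1' := mul_le_mul_of_nonneg_left h1 hP
      simp only [loK, pow_succ]
      nlinarith
    · have h1 := (hx i).2
      have h2 := (hxe i).2
      simp only [bondHi, Pi.smul_apply, smul_eq_mul, add_e_apply] at h1 h2
      have h1' := mul_le_mul_of_nonneg_left h1 hP
      have h2' := mul_le_mul_of_nonneg_left h2 hP
      simp only [bondHiK, pow_succ]
      split_ifs at h1' h2' ⊢ <;> nlinarith

/-- Upper corner of the union `B^k(x) ∪ B^k(y) ∪ B^k(z) ∪ B^k(w)` of the four `k`-blocks at the corners of the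
plaquette `p = (z; μ, ν)` of the `k`-th lattice (lower corner `L^k z`): `L^k z + (L^k − 1)𝟙 + L^k e_μ + L^k e_ν`.
For `k = 1` this is `Δ(p′)` (46). [cite: Balaban1985Averaging, (46) p.25, p.26 (sentence after (54))] -/
def plaqHiK (L k : ℕ) (z : Site d) (μ ν : Fin d) : Site d := fun i =>
  (L : ℤ) ^ k * z i + ((L : ℤ) ^ k - 1) + if i = μ ∨ i = ν then (L : ℤ) ^ k else 0

/-- **LOCALITY OF `Ū^k(∂p)`** (p. 26: the plaquette variable of the `k`-fold average at `p = ⟨x, y, z, w⟩` depends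
only on `U_b`, `b ⊂ B^k(x) ∪ B^k(y) ∪ B^k(z) ∪ B^k(w)`). [cite: Balaban1985Averaging, p.26 (sentence after (54))] -/
theorem hol_plaqWord_avgIter_congr (L : ℕ) (hL : 1 ≤ L) (k : ℕ) (z : Site d) (μ ν : Fin d)
    (h : AgreeOn (loK L k z) (plaqHiK L k z μ ν) V V') :
    hol (avgIter L V k) z (plaqWord μ ν) = hol (avgIter L V' k) z (plaqWord μ ν) := by
  rcases eq_or_ne μ ν with rfl | hμν
  · rw [hol_plaqWord_self, hol_plaqWord_self]
  have hP : (0 : ℤ) ≤ (L : ℤ) ^ k := by positivity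
  have key : ∀ (x : Site d) (κ : Fin d), (∀ i, z i ≤ x i) →
      (∀ i, (L : ℤ) ^ k * x i + (if i = κ then (L : ℤ) ^ k else 0) ≤
        (L : ℤ) ^ k * z i + if i = μ ∨ i = ν then (L : ℤ) ^ k else 0) →
      avgIter L V k x κ = avgIter L V' k x κ := fun x κ hlo hhi =>
    avgIter_congr L hL k x κ (h.mono (fun i => by simp only [loK]; nlinarith [hlo i, hP])
      (fun i => by simp only [bondHiK, plaqHiK]; linarith [hhi i]))
  have hzμ : ∀ i, z i ≤ (z + e μ) i := fun i => by rw [add_e_apply]; split_ifs <;> omega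
  have hzν : ∀ i, z i ≤ (z + e ν) i := fun i => by rw [add_e_apply]; split_ifs <;> omega
  rw [hol_plaqWord_eq, hol_plaqWord_eq, key z μ (fun i => le_rfl) ?_, key (z + e μ) ν hzμ ?_,
    key (z + e ν) μ hzν ?_, key z ν (fun i => le_rfl) ?_]
  all_goals intro i
  all_goals try rw [add_e_apply]
  all_goals split_ifs <;> first | nlinarith [hP] | (exfalso; simp_all)

end Average

/-! ## §3 The clamped extension of a configuration given on a box -/

section Clamp

/-- The coordinatewise nearest-point retraction `π : ℤ^d → [lo, hi]`, `π(x)_i = max(lo_i, min(x_i, hi_i))`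
(a device of this file, not in print). [folklore] -/
def clamp (lo hi x : Site d) : Site d := fun i => max (lo i) (min (x i) (hi i))

variable {lo hi : Site d}

/-- `π(x) ∈ [lo, hi]`. [folklore] -/
theorem clamp_inBox (hlohi : ∀ i, lo i ≤ hi i) (x : Site d) : InBox lo hi (clamp lo hi x) := fun i => by
  simp only [clamp, max_def, min_def]
  have := hlohi i
  split_ifs <;> omega

/-- `π(x) = x` on the box. [folklore] -/
theorem clamp_of_inBox {x : Site d} (hx : InBox lo hi x) : clamp lo hi x = x := funext fun i => by
  simp only [clamp, max_def, min_def]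
  have := hx i
  split_ifs <;> omega

/-- `π(x + e_κ) = π(x) + e_κ` when `lo_κ ≤ x_κ < hi_κ` (the bond `⟨π(x), π(x + e_κ)⟩` is a genuine bond of the box). [folklore] -/
theorem clamp_add_e_of {x : Site d} {κ : Fin d} (h : lo κ ≤ x κ ∧ x κ < hi κ) :
    clamp lo hi (x + e κ) = clamp lo hi x + e κ := funext fun i => by
  by_cases hi : i = κ
  · subst hi
    simp only [clamp, add_e_apply, if_true, max_def, min_def]
    split_ifs <;> omega
  · simp only [clamp, add_e_apply, if_neg hi, add_zero]

/-- `π(x + e_κ) = π(x)` otherwise (the bond degenerates to a point). [folklore] -/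
theorem clamp_add_e_of_not {x : Site d} {κ : Fin d} (hκ : lo κ ≤ hi κ) (h : ¬ (lo κ ≤ x κ ∧ x κ < hi κ)) :
    clamp lo hi (x + e κ) = clamp lo hi x := funext fun i => by
  by_cases hi : i = κ
  · subst hi
    simp only [clamp, add_e_apply, if_true, max_def, min_def]
    split_ifs <;> omega
  · simp only [clamp, add_e_apply, if_neg hi, add_zero]

variable {G : Type*} [Group G]

/-- THE CLAMPED EXTENSION `π^*V` of a configuration `V` given on the box: `(π^*V)(x, x + e_κ) = V(π(x), π(x) + e_κ)`
on genuine bonds and `= 1` on degenerate ones.  It is defined on all of `ℤ^d`, agrees with `V` on the bonds of the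
box, and each of its plaquette variables is either `1` or a plaquette variable of `V` INSIDE the box
(`hol_plaqWord_clampCfg`) — so a local hypothesis (44) on the box becomes a global one. [folklore] -/
def clampCfg (lo hi : Site d) (V : Site d → Fin d → G) : Site d → Fin d → G := fun x κ =>
  if lo κ ≤ x κ ∧ x κ < hi κ then V (clamp lo hi x) κ else 1

/-- `π^*V = V` on the bonds of the box. [folklore] -/
theorem clampCfg_agree (V : Site d → Fin d → G) : AgreeOn lo hi (clampCfg lo hi V) V := fun x κ hx hxe => by
  have h1 : lo κ ≤ x κ ∧ x κ < hi κ := ⟨(hx κ).1, by have := (hxe κ).2; rw [add_e_apply, if_pos rfl] at this; omega⟩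
  simp only [clampCfg, h1, and_self, if_true, clamp_of_inBox hx]

/-- `π^*V` takes values in any subgroup containing the values of `V`. [folklore] -/
theorem clampCfg_mem {S : Subgroup G} {V : Site d → Fin d → G} (hV : ∀ x κ, V x κ ∈ S) (x : Site d) (κ : Fin d) :
    clampCfg lo hi V x κ ∈ S := by
  unfold clampCfg; split_ifs; exacts [hV _ _, S.one_mem]

/-- THE KEY CASE ANALYSIS: every plaquette variable of `π^*V` is `1` or the variable of a plaquette of `V` lying
in the box (the one at `π(x)`). [folklore] -/
theorem hol_plaqWord_clampCfg (hlohi : ∀ i, lo i ≤ hi i) (V : Site d → Fin d → G) (x : Site d) {κ ν : Fin d}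
    (hκν : κ ≠ ν) :
    hol (clampCfg lo hi V) x (plaqWord κ ν) = 1 ∨
      (PlaqIn lo hi (clamp lo hi x, κ, ν) ∧
        hol (clampCfg lo hi V) x (plaqWord κ ν) = hol V (clamp lo hi x) (plaqWord κ ν)) := by
  rw [hol_plaqWord_eq, hol_plaqWord_eq]
  have hκ' : (x + e ν) κ = x κ := by rw [add_e_apply, if_neg hκν, add_zero]
  have hν' : (x + e κ) ν = x ν := by rw [add_e_apply, if_neg hκν.symm, add_zero]
  simp only [clampCfg, hκ', hν']
  by_cases P : lo κ ≤ x κ ∧ x κ < hi κ <;> by_cases Q : lo ν ≤ x ν ∧ x ν < hi ν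
  · right
    have Q' : lo ν ≤ (x + e κ) ν ∧ (x + e κ) ν < hi ν := by rw [hν']; exact Q
    have hc : clamp lo hi x + e κ + e ν = clamp lo hi (x + e κ + e ν) := by
      rw [clamp_add_e_of Q', clamp_add_e_of P]
    refine ⟨⟨clamp_inBox hlohi x, by rw [hc]; exact clamp_inBox hlohi _⟩, ?_⟩
    simp only [if_pos P, if_pos Q, clamp_add_e_of P, clamp_add_e_of Q]
  · left
    simp only [if_pos P, if_neg Q, clamp_add_e_of_not (hlohi ν) Q, mul_one, inv_one, mul_inv_cancel]
  · left
    simp only [if_neg P, if_pos Q, clamp_add_e_of_not (hlohi κ) P, one_mul, inv_one, mul_one, mul_inv_cancel]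
  · left
    simp only [if_neg P, if_neg Q, inv_one, mul_one]

/-- Consequence: (44) for the plaquettes of `V` INSIDE the box, in the direction pair `(κ, ν)`, gives (44) for ALL
plaquettes of `π^*V` in that direction pair, with the same `α₀`. [folklore] -/
theorem norm_hol_plaqWord_clampCfg_le {𝔸 : Type*} [NormedRing 𝔸] (hlohi : ∀ i, lo i ≤ hi i)
    (V : Site d → Fin d → 𝔸ˣ) {κ ν : Fin d} (hκν : κ ≠ ν) {α : ℝ} (hα : 0 ≤ α)
    (h44 : ∀ x, PlaqIn lo hi (x, κ, ν) → ‖((hol V x (plaqWord κ ν) : 𝔸ˣ) : 𝔸) - 1‖ ≤ α) (x : Site d) :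
    ‖((hol (clampCfg lo hi V) x (plaqWord κ ν) : 𝔸ˣ) : 𝔸) - 1‖ ≤ α := by
  rcases hol_plaqWord_clampCfg hlohi V x hκν with h | ⟨h1, h2⟩
  · rw [h]; simpa using hα
  · rw [h2]; exact h44 _ h1

end Clamp

/-! ## §4 Proposition 1 (51) under the printed local hypothesis "(44) for `p ⊂ Δ(p′)`" -/

section Prop1

/-- **(46)** `Δ(p′) = B(y₀) ∪ B(y₁) ∪ B(y₂) ∪ B(y)`, the union of the four blocks at the corners of the plaquette
`p′` of the `L`-lattice with lower-left corner `z = y₀` spanned by `e_μ, e_ν` (`y = z + Le_μ + Le_ν` its upper right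
corner): the box `[z, z + (L−1)𝟙 + Le_μ + Le_ν]` (upper corner; blocks `B(y) = y + [0, L)^d`, B5 (1.6)).
[cite: Balaban1985Averaging, (46) p.25] -/
def deltaHi (L : ℕ) (z : Site d) (μ ν : Fin d) : Site d := fun i =>
  z i + ((L : ℤ) - 1) + if i = μ ∨ i = ν then (L : ℤ) else 0

/-- `Δ(p′)` of the plaquette `p′` with lower corner `Lz` is the case `k = 1` of the four-`k`-block box of the
plaquette `(z; μ, ν)` of the first lattice. [folklore] -/
theorem plaqHiK_one (L : ℕ) (z : Site d) (μ ν : Fin d) : plaqHiK L 1 z μ ν = deltaHi L ((L : ℤ) • z) μ ν := by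
  funext i; simp [plaqHiK, deltaHi]

variable {𝔸 : Type*} [NormedRing 𝔸] [NormOneClass 𝔸] [NormedAlgebra ℂ 𝔸] [CompleteSpace 𝔸]

omit [NormOneClass 𝔸] in
/-- LOCALITY OF `V̄(∂p′)`: configurations agreeing on the bonds of `Δ(p′)` have the same `V̄(∂p′)` (p. 25: "the
contours `Γ_{c,x}` are contained in `Δ(p′)`"). [cite: Balaban1985Averaging, p.25 (line after (46))] -/
theorem cplaq_bavg_congr (L : ℕ) (hL : 1 ≤ L) (z : Site d) {μ ν : Fin d} (hμν : μ ≠ ν)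
    {V V' : Site d → Fin d → 𝔸ˣ} (h : AgreeOn z (deltaHi L z μ ν) V V') :
    cplaq L (bavg L V) z μ ν = cplaq L (bavg L V') z μ ν := by
  have key : ∀ (q : Site d) (κ : Fin d), (∀ i, z i ≤ q i) →
      (∀ i, q i + (if i = κ then (L : ℤ) else 0) ≤ z i + if i = μ ∨ i = ν then (L : ℤ) else 0) →
      bavg L V q κ = bavg L V' q κ := fun q κ hlo hhi =>
    bavg_congr L hL q κ (h.mono hlo fun i => by simp only [bondHi, deltaHi]; linarith [hhi i])
  have hzμ : ∀ i, z i ≤ (z + (L : ℤ) • e μ) i := fun i => by rw [add_zsmul_e_apply]; split_ifs <;> omega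
  have hzν : ∀ i, z i ≤ (z + (L : ℤ) • e ν) i := fun i => by rw [add_zsmul_e_apply]; split_ifs <;> omega
  unfold cplaq
  rw [key z μ (fun i => le_rfl) ?_, key (z + (L : ℤ) • e μ) ν hzμ ?_, key (z + (L : ℤ) • e ν) μ hzν ?_,
    key z ν (fun i => le_rfl) ?_]
  all_goals intro i
  all_goals try rw [add_zsmul_e_apply]
  all_goals split_ifs <;> omega

/-- **PROPOSITION 1 (51) WITH THE PRINTED LOCAL HYPOTHESIS** (p. 26: "for every configuration `V` satisfying (44)
for `p ⊂ Δ(p′)` and for `α₀ ≤ c₂′`, we have `|V̄(∂p′) − 1| < L²α₀ + C₀(L²α₀)²`"; p. 25: "Let us notice that it is a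
local result; the bound above depends on bounds for `V(∂p) − 1` on `Δ(p′)`, i.e., for `p ⊂ Δ(p′)`"), kernel-checked
with the constants of `B7Prop1Explicit.prop1_explicit` (`C₀ = 14464(d+1)²(d+4)²`, `c₂′ = 1/(512(d+1)(d+4)L²)`):
(44) is assumed ONLY for the unit plaquettes `p ⊂ Δ(p′)` (46).  Proof: the clamped extension `π^*V` of `V|Δ(p′)`
satisfies (44) on all of `ℤ^d` (`norm_hol_plaqWord_clampCfg_le`), the global theorem applies to it, and
`V̄(∂p′)` is the same for `V` and `π^*V` (`cplaq_bavg_congr`). [cite: Balaban1985Averaging, Prop. 1 (51) p.26] -/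
theorem prop1_local (L : ℕ) (hL : 1 ≤ L) (z : Site d) {μ ν : Fin d} (hμν : μ ≠ ν)
    (V : Site d → Fin d → 𝔸ˣ) (hV : ∀ x κ, V x κ ∈ U1 𝔸) {α₀ : ℝ} (hα₀ : 0 ≤ α₀)
    (hsmall : 512 * (d + 1) * (d + 4) * (L : ℝ) ^ 2 * α₀ ≤ 1)
    (h44 : ∀ (x : Site d) (κ κ' : Fin d), κ ≠ κ' → PlaqIn z (deltaHi L z μ ν) (x, κ, κ') →
      ‖((hol V x (plaqWord κ κ') : 𝔸ˣ) : 𝔸) - 1‖ ≤ α₀) :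
    ‖((cplaq L (bavg L V) z μ ν : 𝔸ˣ) : 𝔸) - 1‖
      ≤ (L : ℝ) ^ 2 * α₀ + 226 * (8 * (d + 1) * (d + 4) * (L : ℝ) ^ 2 * α₀) ^ 2 := by
  have hlohi : ∀ i, z i ≤ deltaHi L z μ ν i := fun i => by simp only [deltaHi]; split_ifs <;> omega
  set V' := clampCfg z (deltaHi L z μ ν) V with hV'
  have hV'1 : ∀ x κ, V' x κ ∈ U1 𝔸 := clampCfg_mem hV
  have h44' : ∀ (x : Site d) (κ κ' : Fin d), κ ≠ κ' → ‖((hol V' x (plaqWord κ κ') : 𝔸ˣ) : 𝔸) - 1‖ ≤ α₀ :=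
    fun x κ κ' hκκ' => norm_hol_plaqWord_clampCfg_le hlohi V hκκ' hα₀ (fun x hx => h44 x κ κ' hκκ' hx) x
  rw [cplaq_bavg_congr L hL z hμν (clampCfg_agree V).symm]
  exact prop1_explicit L hL z hμν V' hV'1 hα₀ hsmall h44'

end Prop1

/-! ### The quoted leaf `B7.Prop1Printed` with the printed locality, instantiated and proved -/

section Concrete1

variable {𝔸 : Type} [NormedRing 𝔸] [NormOneClass 𝔸] [NormedAlgebra ℂ 𝔸] [CompleteSpace 𝔸]

variable (𝔸) in
/-- The concrete one-step family of B7 Sect. B on `ℤ^d` EXACTLY AS THE CARRIER `B7.OneStep` READS ("`plaqDev V` =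
sup over unit plaquettes `p ⊂ Δ(p′)` of `|V(∂p) − 1|` (hypothesis (44))"): index `i = (y₀, μ, ν)` = the plaquette
`p′` of the `L`-lattice; `Cfg` = configurations with values in `{|u| ≤ 1, |u⁻¹| ≤ 1}`; `plaqDev V` = the supremum
over the plaquettes INSIDE `Δ(p′)` (46) only (cf. `B7Prop1Explicit.concreteOneStep`: over all plaquettes of `ℤ^d`);
`avgDev V = |V̄(∂p′) − 1|`.  Prop. 3 fields trivial. [cite: Balaban1985Averaging, (44) p.24, (46) p.25, Prop. 1 p.26] -/
def concreteOneStepLocal (L : ℕ) (i : {p : Site d × Fin d × Fin d // p.2.1 ≠ p.2.2}) : B7.OneStep where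
  Cfg := {V : Site d → Fin d → 𝔸ˣ // ∀ x κ, V x κ ∈ U1 𝔸}
  Fld := Unit
  plaqDev V := ⨆ p : {p : Site d × Fin d × Fin d // PlaqIn i.1.1 (deltaHi L i.1.1 i.1.2.1 i.1.2.2) p},
    ‖((hol V.1 p.1.1 (plaqWord p.1.2.1 p.1.2.2) : 𝔸ˣ) : 𝔸) - 1‖
  avgDev V := ‖((cplaq L (bavg L V.1) i.1.1 i.1.2.1 i.1.2.2 : 𝔸ˣ) : 𝔸) - 1‖
  fldNorm _ := 0
  IsAnalyticQ _ _ := True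
  remC _ _ := 0

/-- **Proposition 1 of B7 as printed, locality included (`B7.Prop1Printed` over `concreteOneStepLocal`), PROVED**
for the concrete block average (42) on `ℤ^d` with `G ⊂ {|u| ≤ 1, |u⁻¹| ≤ 1}`, `L ≥ 1`, `d ≥ 2`, with
`C₀ = 14464(d+1)²(d+4)²`, `c₂′ = 1/(512(d+1)(d+4)L²)`: (44) is required only for `p ⊂ Δ(p′)`.  This discharges
DIVERGENCE (a) of `B7Prop1Explicit` (cell D-b07g13.1 (a)). [cite: Balaban1985Averaging, Prop. 1 (51) p.26] -/
theorem prop1Printed_concrete_local (L : ℕ) (hL : 1 ≤ L) :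
    B7.Prop1Printed (L : ℝ) (concreteOneStepLocal 𝔸 (d := d) L) := by
  refine ⟨226 * (8 * ((d : ℝ) + 1) * (d + 4)) ^ 2, 1 / (512 * ((d : ℝ) + 1) * (d + 4) * (L : ℝ) ^ 2),
    by positivity, by positivity, ?_⟩
  rintro ⟨⟨z, μ, ν⟩, hμν⟩ α₀ hα₀ hc ⟨V, hV⟩ hdev
  simp only [concreteOneStepLocal] at hdev ⊢
  set I := {p : Site d × Fin d × Fin d // PlaqIn z (deltaHi L z μ ν) p}
  have hbdd : BddAbove (Set.range fun p : I => ‖((hol V p.1.1 (plaqWord p.1.2.1 p.1.2.2) : 𝔸ˣ) : 𝔸) - 1‖) :=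
    ⟨2, by rintro _ ⟨p, rfl⟩; exact norm_hol_sub_one_le_two hV _ _⟩
  set s := ⨆ p : I, ‖((hol V p.1.1 (plaqWord p.1.2.1 p.1.2.2) : 𝔸ˣ) : 𝔸) - 1‖ with hs
  have hs0 : 0 ≤ s := Real.iSup_nonneg fun _ => norm_nonneg _
  set α₁ := (s + α₀) / 2 with hα₁
  have hα₁0 : 0 ≤ α₁ := by positivity
  have hα₁α₀ : α₁ < α₀ := by rw [hα₁]; linarith
  have hα₁α₀' : α₁ ≤ α₀ := hα₁α₀.le
  have h44 : ∀ (x : Site d) (κ κ' : Fin d), κ ≠ κ' → PlaqIn z (deltaHi L z μ ν) (x, κ, κ') →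
      ‖((hol V x (plaqWord κ κ') : 𝔸ˣ) : 𝔸) - 1‖ ≤ α₁ := by
    intro x κ κ' _ hx
    have := le_ciSup hbdd ⟨(x, κ, κ'), hx⟩
    simp only at this
    linarith
  have hLr : (1 : ℝ) ≤ L := by exact_mod_cast hL
  have hsmall : 512 * (d + 1) * (d + 4) * (L : ℝ) ^ 2 * α₁ ≤ 1 := by
    have hpos : 0 < 512 * ((d : ℝ) + 1) * (d + 4) * (L : ℝ) ^ 2 := by positivity
    have h1 := (le_div_iff₀ hpos).mp hc
    have h2 := mul_le_mul_of_nonneg_left hα₁α₀' hpos.le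
    linarith
  have hmain := prop1_local L hL z hμν V hV hα₁0 hsmall h44
  refine hmain.trans_lt ?_
  have hL2 : 0 < (L : ℝ) ^ 2 := by positivity
  have h1 : (L : ℝ) ^ 2 * α₁ < (L : ℝ) ^ 2 * α₀ := by gcongr
  have h2 : (8 * ((d : ℝ) + 1) * (d + 4) * (L : ℝ) ^ 2 * α₁) ^ 2 ≤
      (8 * ((d : ℝ) + 1) * (d + 4) * (L : ℝ) ^ 2 * α₀) ^ 2 := by gcongr
  nlinarith

end Concrete1

/-! ## §5 Proposition 2 (54) under the printed local hypothesis "(52) on the four `k`-blocks at the corners" -/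

section Prop2

variable {𝔸 : Type*} [NormedRing 𝔸] [NormOneClass 𝔸] [NormedAlgebra ℂ 𝔸] [CompleteSpace 𝔸]

omit [NormOneClass 𝔸] [NormedAlgebra ℂ 𝔸] [CompleteSpace 𝔸] in
/-- `sup |V(∂p) − 1|` over the unit plaquettes `p ⊂ [lo, hi]` only (a real supremum; `0` for no plaquettes).
[cite: Balaban1985Averaging, (44) p.24, (52) p.26] -/
def pdevOn (lo hi : Site d) (V : Site d → Fin d → 𝔸ˣ) : ℝ :=
  ⨆ p : {p : Site d × Fin d × Fin d // PlaqIn lo hi p}, ‖((hol V p.1.1 (plaqWord p.1.2.1 p.1.2.2) : 𝔸ˣ) : 𝔸) - 1‖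

omit [NormOneClass 𝔸] [NormedAlgebra ℂ 𝔸] [CompleteSpace 𝔸] in
/-- `pdevOn_nonneg`: a supremum of norms is `≥ 0`. [folklore] -/
theorem pdevOn_nonneg (lo hi : Site d) (V : Site d → Fin d → 𝔸ˣ) : 0 ≤ pdevOn lo hi V :=
  Real.iSup_nonneg fun _ => norm_nonneg _

omit [NormedAlgebra ℂ 𝔸] [CompleteSpace 𝔸] in
/-- `pdevOn` is a genuine supremum: every `|V(∂p) − 1| ≤ 2` for values in `{|u| ≤ 1, |u⁻¹| ≤ 1}`. [folklore] -/
theorem pdevOn_bddAbove (lo hi : Site d) {V : Site d → Fin d → 𝔸ˣ} (hV : ∀ x κ, V x κ ∈ U1 𝔸) :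
    BddAbove (Set.range fun p : {p : Site d × Fin d × Fin d // PlaqIn lo hi p} =>
      ‖((hol V p.1.1 (plaqWord p.1.2.1 p.1.2.2) : 𝔸ˣ) : 𝔸) - 1‖) := by
  refine ⟨2, ?_⟩
  rintro _ ⟨p, rfl⟩
  refine (norm_sub_le _ _).trans ?_
  rw [norm_one]
  have := (hol_mem hV p.1.1 (plaqWord p.1.2.1 p.1.2.2)).1
  linarith

omit [NormedAlgebra ℂ 𝔸] [CompleteSpace 𝔸] in
/-- `le_pdevOn`: each plaquette inside the box is bounded by the supremum. [folklore] -/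
theorem le_pdevOn {lo hi : Site d} {V : Site d → Fin d → 𝔸ˣ} (hV : ∀ x κ, V x κ ∈ U1 𝔸)
    {p : Site d × Fin d × Fin d} (hp : PlaqIn lo hi p) :
    ‖((hol V p.1 (plaqWord p.2.1 p.2.2) : 𝔸ˣ) : 𝔸) - 1‖ ≤ pdevOn lo hi V :=
  le_ciSup (pdevOn_bddAbove lo hi hV) ⟨p, hp⟩

omit [NormedAlgebra ℂ 𝔸] [CompleteSpace 𝔸] in
/-- The global plaquette deviation of the clamped extension is at most the deviation of `V` INSIDE the box. [folklore] -/
theorem pdev_clampCfg_le {lo hi : Site d} (hlohi : ∀ i, lo i ≤ hi i) {V : Site d → Fin d → 𝔸ˣ}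
    (hV : ∀ x κ, V x κ ∈ U1 𝔸) : pdev (clampCfg lo hi V) ≤ pdevOn lo hi V := by
  refine Real.iSup_le (fun p => ?_) (pdevOn_nonneg lo hi V)
  obtain ⟨x, κ, ν⟩ := p
  rcases eq_or_ne κ ν with rfl | hκν
  · simp only [hol_plaqWord_self, Units.val_one, sub_self, norm_zero]; exact pdevOn_nonneg lo hi V
  rcases hol_plaqWord_clampCfg hlohi V x hκν with h | ⟨h1, h2⟩
  · simp only [h, Units.val_one, sub_self, norm_zero]; exact pdevOn_nonneg lo hi V
  · simp only [h2]; exact le_pdevOn hV h1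

/-- **PROPOSITION 2 (54) WITH THE PRINTED LOCALITY** (p. 26, the sentence after (54): "The result is local in the
sense that if `p = ⟨x, y, z, w⟩`, then it is enough to assume (52) for `p ⊂ B^k(x) ∪ B^k(y) ∪ B^k(z) ∪ B^k(w)`"),
kernel-checked with the constants of `B7Prop2Explicit.prop2_explicit`: for a `G`-valued configuration
(`G` any `AvgClosed` gauge group, e.g. `U(N)`), `L ≥ 2`, `C₀α₀ ≤ ⅓`, `2α₀ ≤ c₂′`, and (52) `sup |U(∂p′) − 1| · L^{2k}
< α₀` over the unit plaquettes `p′` INSIDE the union of the four `k`-blocks at the corners of the plaquette `p` of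
the `k`-th lattice only, `|Ū^k(∂p) − 1| < α₀ + 2C₀α₀²`.  Proof: the clamped extension of `U` restricted to that box
satisfies (52) everywhere and is `G`-valued, the global theorem applies, and `Ū^k(∂p)` is the same for both
(`hol_plaqWord_avgIter_congr`). [cite: Balaban1985Averaging, Prop. 2 (54) p.26 + the sentence after it] -/
theorem prop2_local (L : ℕ) (hL : 2 ≤ L) {G : Subgroup 𝔸ˣ} (hG : AvgClosed d L G) (k : ℕ)
    (V : Site d → Fin d → 𝔸ˣ) (hV : ∀ x κ, V x κ ∈ G) {α₀ : ℝ} (hα : 0 < α₀)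
    (hα3 : C0 d * α₀ ≤ 1 / 3) (hα2 : 2 * α₀ ≤ c2' d L) (z : Site d) (μ ν : Fin d)
    (h52 : pdevOn (loK L k z) (plaqHiK L k z μ ν) V < α₀ * (((L : ℝ) ^ k)⁻¹) ^ 2) :
    ‖((hol (avgIter L V k) z (plaqWord μ ν) : 𝔸ˣ) : 𝔸) - 1‖ < α₀ + 2 * C0 d * α₀ ^ 2 := by
  have hL1 : 1 ≤ L := le_trans (by norm_num) hL
  have hP : (1 : ℤ) ≤ (L : ℤ) ^ k := one_le_pow₀ (by exact_mod_cast hL1)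
  have hlohi : ∀ i, loK L k z i ≤ plaqHiK L k z μ ν i := fun i => by
    simp only [loK, plaqHiK]; split_ifs <;> linarith
  set V' := clampCfg (loK L k z) (plaqHiK L k z μ ν) V with hV'
  have hV'G : ∀ x κ, V' x κ ∈ G := clampCfg_mem hV
  have hVU : ∀ x κ, V x κ ∈ U1 𝔸 := fun x κ => hG.le_U1 (hV x κ)
  have h52' : pdev V' < α₀ * (((L : ℝ) ^ k)⁻¹) ^ 2 := (pdev_clampCfg_le hlohi hVU).trans_lt h52
  obtain ⟨hbound, hmem⟩ := prop2_explicit L hL hG k V' hV'G hα hα3 hα2 h52'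
  have hkU : ∀ x κ, avgIter L V' k x κ ∈ U1 𝔸 := fun x κ => hG.le_U1 (hmem k le_rfl x κ)
  rw [hol_plaqWord_avgIter_congr L hL1 k z μ ν (clampCfg_agree V).symm]
  exact (le_pdev hkU z μ ν).trans_lt hbound

end Prop2

/-! ### The quoted leaf `B7.Prop2Printed` with the printed locality, instantiated and proved -/

section Concrete2

variable {𝔸 : Type} [NormedRing 𝔸] [NormOneClass 𝔸] [NormedAlgebra ℂ 𝔸] [CompleteSpace 𝔸]

variable (d 𝔸) in
/-- The concrete `k`-fold family of B7 Sect. B read on the unit lattice WITH THE PRINTED LOCALITY: index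
`i = (k, z, μ, ν)` = a plaquette `p` of the `k`-th lattice `Ω^{(k)}` (lower-left corner `z`, directions `μ, ν`);
`Cfg` = `G`-valued configurations; `plaqDevEta U = sup_{p′ ⊂ B^k(x) ∪ B^k(y) ∪ B^k(z) ∪ B^k(w)} |U(∂p′) − 1| · η^{−2}`
(hypothesis (52) on the four `k`-blocks at the corners of `p` only); `avgDevK U = |Ū^k(∂p) − 1|` (conclusion (54) at
`p`).  Cf. `B7Prop2Explicit.concreteKStep` (both suprema over all plaquettes). [cite: Balaban1985Averaging, (52)–(54) p.26] -/
def concreteKStepLocal (G : Subgroup 𝔸ˣ) (L : ℕ) (i : ℕ × Site d × Fin d × Fin d) : B7.KStep where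
  Cfg := {V : Site d → Fin d → 𝔸ˣ // ∀ x κ, V x κ ∈ G}
  k := i.1
  plaqDevEta V := pdevOn (loK L i.1 i.2.1) (plaqHiK L i.1 i.2.1 i.2.2.1 i.2.2.2) V.1 * ((L : ℝ) ^ i.1) ^ 2
  avgDevK V := ‖((hol (avgIter L V.1 i.1) i.2.1 (plaqWord i.2.2.1 i.2.2.2) : 𝔸ˣ) : 𝔸) - 1‖

/-- **Proposition 2 of B7 as printed, locality included (`B7.Prop2Printed` over `concreteKStepLocal`), PROVED** for
the concrete `k`-fold average (43) on `ℤ^d` (`L ≥ 2`) with values in any `AvgClosed` gauge group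
`G ⊂ {|u| ≤ 1, |u⁻¹| ≤ 1}`, with `C₀ = 14464(d+1)²(d+4)²`, `c₂′ = 1/(512(d+1)(d+4)L²)`, `c₂ = min{1/(3C₀), ½c₂′}`
exactly as printed; uniformly in `k` and in the plaquette.  This discharges DIVERGENCE (a) of `B7Prop2Explicit`
(cell D-b07g14.1 (a)). [cite: Balaban1985Averaging, Prop. 2 (52)–(54) p.26] -/
theorem prop2Printed_concrete_local (L : ℕ) (hL : 2 ≤ L) {G : Subgroup 𝔸ˣ} (hG : AvgClosed d L G) :
    B7.Prop2Printed (C0 d) (c2' d L) (concreteKStepLocal d 𝔸 G L) := by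
  rintro ⟨k, z, μ, ν⟩ α₀ hα₀ hαmin V h52
  obtain ⟨V, hV⟩ := V
  simp only [concreteKStepLocal] at h52 ⊢
  have hC := C0_pos d
  have hα3 : C0 d * α₀ ≤ 1 / 3 := by
    have h := hαmin.trans (min_le_left _ _)
    rw [le_div_iff₀ (by positivity : (0 : ℝ) < 3 * C0 d)] at h
    linarith
  have hα2 : 2 * α₀ ≤ c2' d L := by
    have h := hαmin.trans (min_le_right _ _)
    linarith
  have hLk : (0 : ℝ) < ((L : ℝ) ^ k) ^ 2 := by
    have : (2 : ℝ) ≤ L := by exact_mod_cast hL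
    positivity
  have h52' : pdevOn (loK L k z) (plaqHiK L k z μ ν) V < α₀ * (((L : ℝ) ^ k)⁻¹) ^ 2 := by
    rw [inv_pow, ← div_eq_mul_inv, lt_div_iff₀ hLk]
    exact h52
  exact prop2_local L hL hG k V hV hα₀ hα3 hα2 z μ ν h52'

end Concrete2

/-! ## §6 Gauge groups closed at radius `t` (`SU(N)`), and the paper's settings `G = U(N)`, `SU(N) ⊂ M_N(ℂ)` -/

section Prop2At

variable {𝔸 : Type*} [NormedRing 𝔸] [NormOneClass 𝔸] [NormedAlgebra ℂ 𝔸] [CompleteSpace 𝔸]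

/-- **Proposition 2 (54) with the printed locality, for a gauge group closed under (42) at radius `t`**
(`B7Prop2SpecialUnitary.AvgClosedAt`, e.g. `SU(N)` with `Nt < π`): as `prop2_local`, with the one extra
smallness `32(d+1)(d+4)L²α₀ ≤ t` of `B7Prop2SpecialUnitary.prop2_explicit_at`. [cite: Balaban1985Averaging, Prop. 2 (54) p.26 + the sentence after it] -/
theorem prop2_local_at (L : ℕ) (hL : 2 ≤ L) {G : Subgroup 𝔸ˣ} {t : ℝ} (hG : AvgClosedAt d t L G) (k : ℕ)
    (V : Site d → Fin d → 𝔸ˣ) (hV : ∀ x κ, V x κ ∈ G) {α₀ : ℝ} (hα : 0 < α₀)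
    (hα3 : C0 d * α₀ ≤ 1 / 3) (hα2 : 2 * α₀ ≤ c2' d L)
    (hαt : 32 * ((d : ℝ) + 1) * (d + 4) * (L : ℝ) ^ 2 * α₀ ≤ t) (z : Site d) (μ ν : Fin d)
    (h52 : pdevOn (loK L k z) (plaqHiK L k z μ ν) V < α₀ * (((L : ℝ) ^ k)⁻¹) ^ 2) :
    ‖((hol (avgIter L V k) z (plaqWord μ ν) : 𝔸ˣ) : 𝔸) - 1‖ < α₀ + 2 * C0 d * α₀ ^ 2 := by
  have hL1 : 1 ≤ L := le_trans (by norm_num) hL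
  have hP : (1 : ℤ) ≤ (L : ℤ) ^ k := one_le_pow₀ (by exact_mod_cast hL1)
  have hlohi : ∀ i, loK L k z i ≤ plaqHiK L k z μ ν i := fun i => by
    simp only [loK, plaqHiK]; split_ifs <;> linarith
  set V' := clampCfg (loK L k z) (plaqHiK L k z μ ν) V with hV'
  have hV'G : ∀ x κ, V' x κ ∈ G := clampCfg_mem hV
  have hVU : ∀ x κ, V x κ ∈ U1 𝔸 := fun x κ => hG.le_U1 (hV x κ)
  have h52' : pdev V' < α₀ * (((L : ℝ) ^ k)⁻¹) ^ 2 := (pdev_clampCfg_le hlohi hVU).trans_lt h52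
  obtain ⟨hbound, hmem⟩ := prop2_explicit_at L hL hG k V' hV'G hα hα3 hα2 hαt h52'
  have hkU : ∀ x κ, avgIter L V' k x κ ∈ U1 𝔸 := fun x κ => hG.le_U1 (hmem k le_rfl x κ)
  rw [hol_plaqWord_avgIter_congr L hL1 k z μ ν (clampCfg_agree V).symm]
  exact (le_pdev hkU z μ ν).trans_lt hbound

end Prop2At

section Concrete2At

variable {𝔸 : Type} [NormedRing 𝔸] [NormOneClass 𝔸] [NormedAlgebra ℂ 𝔸] [CompleteSpace 𝔸]

/-- `B7.Prop2Printed` with the printed locality for a gauge group closed at radius `t`, with the `G`-dependent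
threshold `c₂′(d, L, t) = min{c₂′, t/(16(d+1)(d+4)L²)}` of `B7Prop2SpecialUnitary.c2At`. [cite: Balaban1985Averaging, Prop. 2 (52)–(54) p.26] -/
theorem prop2Printed_concrete_local_at (L : ℕ) (hL : 2 ≤ L) {G : Subgroup 𝔸ˣ} {t : ℝ}
    (hG : AvgClosedAt d t L G) : B7.Prop2Printed (C0 d) (c2At d L t) (concreteKStepLocal d 𝔸 G L) := by
  rintro ⟨k, z, μ, ν⟩ α₀ hα₀ hαmin V h52
  obtain ⟨V, hV⟩ := V
  simp only [concreteKStepLocal] at h52 ⊢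
  have hL1 : 1 ≤ L := le_trans (by norm_num) hL
  have hC := C0_pos d
  have hα3 : C0 d * α₀ ≤ 1 / 3 := by
    have h := hαmin.trans (min_le_left _ _)
    rw [le_div_iff₀ (by positivity : (0 : ℝ) < 3 * C0 d)] at h
    linarith
  have hα2t : 2 * α₀ ≤ c2At d L t := by
    have h := hαmin.trans (min_le_right _ _)
    linarith
  have hα2 : 2 * α₀ ≤ c2' d L := hα2t.trans (c2At_le d L t)
  have hαt := smallness_of_le_c2At hL1 hα2t
  have hLk : (0 : ℝ) < ((L : ℝ) ^ k) ^ 2 := by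
    have : (2 : ℝ) ≤ L := by exact_mod_cast hL
    positivity
  have h52' : pdevOn (loK L k z) (plaqHiK L k z μ ν) V < α₀ * (((L : ℝ) ^ k)⁻¹) ^ 2 := by
    rw [inv_pow, ← div_eq_mul_inv, lt_div_iff₀ hLk]
    exact h52
  exact prop2_local_at L hL hG k V hV hα₀ hα3 hα2 hαt z μ ν h52'

end Concrete2At

section Matrices

open scoped Matrix.Norms.L2Operator

/-- **Proposition 2 of B7 for `G = U(N)`, `N ≥ 1`, verbatim setting AND printed locality:** configurations on
`ℤ^d` with values in `U(N) ⊂ M_N(ℂ)`, `|·|` the operator norm (19), the `k`-fold average (43), `L ≥ 2`, constants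
`C₀ = 14464(d+1)²(d+4)²`, `c₂′ = 1/(512(d+1)(d+4)L²)`, hypothesis (52) only on the four `k`-blocks at the corners
of `p`; uniformly in `k` and `p` (cf. `B7Prop2Explicit.prop2Printed_unitaryGroup`). [cite: Balaban1985Averaging, Prop. 2 (52)–(54) p.26] -/
theorem prop2Printed_unitaryGroup_local (N : ℕ) [NeZero N] (L : ℕ) (hL : 2 ≤ L) :
    B7.Prop2Printed (C0 d) (c2' d L)
      (concreteKStepLocal d (Matrix (Fin N) (Fin N) ℂ) (unitaryUnits (Matrix (Fin N) (Fin N) ℂ)) L) := by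
  letI : CStarAlgebra (Matrix (Fin N) (Fin N) ℂ) := {}
  exact prop2Printed_concrete_local L hL (avgClosed_unitaryUnits d L)

/-- **Proposition 2 of B7 for `G = SU(N)`, `N ≥ 1`, verbatim setting AND printed locality**, with the threshold
`c₂′(d, L, t_N)`, `t_N = min{1/4, 1/N}` (`= c₂′` for `N ≤ 8`; cf. `B7Prop2SpecialUnitary.prop2Printed_specialUnitaryGroup'`).
[cite: Balaban1985Averaging, Prop. 2 (52)–(54) p.26] -/
theorem prop2Printed_specialUnitaryGroup_local (N : ℕ) [NeZero N] (L : ℕ) (hL : 2 ≤ L) :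
    B7.Prop2Printed (C0 d) (c2At d L (min (1 / 4) (1 / (N : ℝ))))
      (concreteKStepLocal d (Matrix (Fin N) (Fin N) ℂ) (specialUnitaryUnits (Fin N)) L) := by
  have hNr : (0 : ℝ) < N := by exact_mod_cast Nat.pos_of_ne_zero (NeZero.ne N)
  refine prop2Printed_concrete_local_at L hL (avgClosedAt_specialUnitary d L (min_le_left _ _) ?_)
  rw [Fintype.card_fin]
  have hπ : (1 : ℝ) < Real.pi := by have := Real.pi_gt_three; linarith
  calc (N : ℝ) * min (1 / 4) (1 / (N : ℝ)) ≤ (N : ℝ) * (1 / (N : ℝ)) :=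
        mul_le_mul_of_nonneg_left (min_le_right _ _) hNr.le
    _ = 1 := by field_simp
    _ < Real.pi := hπ

end Matrices

end Literature.MathematicalPhysics.QuantumFieldTheory.Balaban1983to89.B7Prop1Local

end
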